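/- Free-seat work of WIDTH SEAT 2/3 `ym-line-cbag-p1-w2` (prover-ym-line-cbag-p1-w2-g16-0), route `EguchiKawaiDirectionLadder`
(ideator ym-idea-2, LINE 8), crux `DirectionIncrement` (stmt-QuantumFields-27725): stub B1 `SingleLinkRigidity` and the crux MODULO the
single random-matrix input (RMT) — the `N`-uniform Hilbert–Schmidt small-ball bound for off-diagonal blocks of a Haar unitary.  Conditional
corollaries; B1 is NOT proved here and nothing bears on the YM mass gap. -/
import Summits.QuantumFields.YangMills.Theorems.EguchiKawaiDirectionLadderSingleLinkReductionCore
import Summits.QuantumFields.YangMills.Theorems.EguchiKawaiDirectionLadderSingleLinkBlocks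
import Summits.QuantumFields.YangMills.Theorems.EguchiKawaiDirectionLadderFubiniIncrement
import Summits.QuantumFields.YangMills.Theorems.EguchiKawaiDirectionLadderDirectionIncrementDefs

/-!
# Route `EguchiKawaiDirectionLadder`, crux `DirectionIncrement`: B1 and the crux modulo (RMT) alone

The route-independent core `singleLinkRigidity_of_blocks_of_offDiagSmallBall` reduces stub B1 to two inputs, (RMT) and (BLOCKS);
(BLOCKS) is PROVED (`blocks_from_centre_symmetry`, `…SingleLinkBlocks`).  Hence, with

  (RMT) `∀ m ∃ C_m ≥ 0 ∀ N, ∀ ℓ : Fin N → Option (Fin m), ∀ 0 < s ≤ 1: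
         Haar{W ∈ U(N) : offDiagBlockSq ℓ W ≤ N·s} ≤ e^{C_m N²} · s^{labelPairCount ℓ / 2}`

— the `N`-uniform Hilbert–Schmidt small-ball bound for the off-diagonal blocks of a Haar unitary relative to ANY block structure
(`labelPairCount/2 = Σ_{i<i'} n_i n_{i'}` = half the real codimension of `U(n₁)×…×U(n_m)·(free)`; Szarek-type metric entropy of the
generalised Stiefel manifold, arXiv:math/9701213 §5; NOT proved in the tree, a research-grade but standard random-matrix estimate) —
we get

* `stub_singleLinkRigidity_of_offDiagSmallBall : (RMT) → SingleLinkRigidity` (the REGISTERED stub B1 of stmt-QuantumFields-27725), and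
* `directionIncrement_of_offDiagSmallBall : (RMT) → DirectionIncrement` (the crux, via the landed Fubini step B2).

So the crux `DirectionIncrement` is now EQUIVALENT-IN-THE-TREE to proving (RMT).  Conditional results; the Yang–Mills mass gap is NOT
proved by anything here (the route bears on the barrier-ledger fact `EguchiKawaiBreakdown`).
-/

set_option autoImplicit false

noncomputable section

open MeasureTheory
open Literature.Barriers.QuantumFields

namespace Summit.QuantumFields.YangMills.Theorems.EguchiKawaiDirectionLadder

/-- (BLOCKS) in the exact shape consumed by `singleLinkRigidity_of_blocks_of_offDiagSmallBall` (the count stated through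
`labelPairCount`), from `blocks_from_centre_symmetry`. -/
theorem blocks_hypothesis :
    ∀ δ : ℝ, 0 < δ → δ < 1 / 2 → ∃ m : ℕ, ∃ γ : ℝ, 0 < γ ∧ ∀ N : ℕ, ∀ d : Fin N → ℂ,
      (∀ j, ‖d j‖ = 1) → ‖(∑ j, d j) / (N : ℂ)‖ ^ 2 ≤ δ → ∃ ℓ : Fin N → Option (Fin m),
        (∀ j k, ℓ j ≠ ℓ k → ℓ j ≠ none → ℓ k ≠ none → γ ≤ ‖d j - d k‖ ^ 2) ∧
          (1 - 2 * δ) / 4 * (N : ℝ) ^ 2 ≤ (labelPairCount ℓ : ℝ) / 2 := by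
  intro δ hδ hδ'
  obtain ⟨m, γ, hγ, h⟩ := blocks_from_centre_symmetry δ hδ hδ'
  refine ⟨m, γ, hγ, fun N d hd hs => ?_⟩
  obtain ⟨ℓ, h1, h2⟩ := h N d hd hs
  refine ⟨ℓ, h1, ?_⟩
  unfold labelPairCount
  convert h2 using 3

/-- **Stub B1 modulo (RMT)**: the `N`-uniform off-diagonal-block small-ball bound for Haar unitaries implies the REGISTERED stub
`SingleLinkRigidity` of stmt-QuantumFields-27725.  (RMT) is NOT proved here. -/
theorem stub_singleLinkRigidity_of_offDiagSmallBall
    (hRMT : ∀ m : ℕ, ∃ Cm : ℝ, 0 ≤ Cm ∧ ∀ N : ℕ, ∀ ℓ : Fin N → Option (Fin m), ∀ s : ℝ, 0 < s → s ≤ 1 →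
      Literature.MathematicalPhysics.QuantumFieldTheory.haarProbability (UN N)
          {W : UN N | offDiagBlockSq ℓ (W : Matrix (Fin N) (Fin N) ℂ) ≤ N * s} ≤
        ENNReal.ofReal (Real.exp (Cm * (N : ℝ) ^ 2) * s ^ ((labelPairCount ℓ : ℝ) / 2))) :
    SingleLinkRigidity := fun δ hδ hδ' =>
  singleLinkRigidity_of_blocks_of_offDiagSmallBall hRMT blocks_hypothesis δ hδ hδ'

/-- **The crux modulo (RMT)**: with the landed Fubini step B2 (`directionIncrement_of_singleLinkRigidity`), the off-diagonal-block
small-ball bound alone gives the route's crux `DirectionIncrement`.  Conditional. -/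
theorem directionIncrement_of_offDiagSmallBall
    (hRMT : ∀ m : ℕ, ∃ Cm : ℝ, 0 ≤ Cm ∧ ∀ N : ℕ, ∀ ℓ : Fin N → Option (Fin m), ∀ s : ℝ, 0 < s → s ≤ 1 →
      Literature.MathematicalPhysics.QuantumFieldTheory.haarProbability (UN N)
          {W : UN N | offDiagBlockSq ℓ (W : Matrix (Fin N) (Fin N) ℂ) ≤ N * s} ≤
        ENNReal.ofReal (Real.exp (Cm * (N : ℝ) ^ 2) * s ^ ((labelPairCount ℓ : ℝ) / 2))) :
    Summit.QuantumFields.YangMills.Theses.EguchiKawaiDirectionLadder.DirectionIncrement :=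
  directionIncrement_of_singleLinkRigidity (stub_singleLinkRigidity_of_offDiagSmallBall hRMT)

end Summit.QuantumFields.YangMills.Theorems.EguchiKawaiDirectionLadder

end
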